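import Summits.BirchSwinnertonDyer.BirchSwinnertonDyer.Theorems.ByReductionTypeAtTwoSupersingularSelmerCorankCyclotomicLayersBounded
import Summits.BirchSwinnertonDyer.BirchSwinnertonDyer.Theorems.ByReductionTypeAtTwoSupersingularClassicalNoFiniteSubmoduleAtTwo
import Literature.NumberTheory.EllipticCurves.KatoTwistedSelmerFinitenessLayers
import HarnessLib

/-!
# Route `ByReductionTypeAtTwo` (rung K4), crux `SupersingularRankZeroAtTwo` (item stmt-BirchSwinnertonDyer-19097), slot 4a `stub_classicalNF`
# (h11): CLASSICAL NF AT GOOD SUPERSINGULAR `2` FROM THREE PRINT INPUTS BY NAME — the Cassels–Tate layer pairing (Literature fact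
# `HachimoriMatsuno2000.casselsTate_layerPairing`), Kato 2004 Cor. 14.3 (1) in the layer form (G1b = Literature fact
# `kato_finite_chiPart_selmerLayer_of_twistedLValue_ne_zero`, `KatoTwistedSelmerFinitenessLayers.lean`; text of record = tower-1 GEN 64
# `HOME/tower/gen64/G1b-binder-text.lean` @1f13ee07bab4991b, pen-elaborated RC-767), and modularity

HONEST FRAMING (cell `bsd-2adic`, run/shared/lean/pub/bsd-2adic/, seat `bsd-2adic-ss-1` GEN 24 = LEAD lineage of 19097; HUMAN RULINGS
D-0036 / D-0054 / D-0074; director-bsd (830)/(836)): THEOREMS ONLY (no definition, no named fact, no instance, no `sorry`, axioms the standard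
trio) — ONE theorem (the composition); CONDITIONAL on the two named Literature facts it displays (`proof.conditional`), which have no `_holds` in the
tree; closes no route item by itself; nothing booked; BSD is not proved by any of this.

WHAT.  Tower-1 GEN 63's ★★ p823354 `OddBlindNF.classicalNoFiniteSubmodule_goodSS_two_of_casselsTateLayerPairing_of_corankBounded (hCT) (hKR)`
gives the registry's `ClassicalNoFiniteSubmoduleSSAtTwo` (= `stub_classicalNF`'s type, line `odd_blind_package` v2.13 04fc80b988a3bb5c) from the
Cassels–Tate layer pairing and a bound on the `ℤ₂`-coranks of `Sel_{2^∞}(E/ℚ_n)`; tower-1 GEN 64's ★★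
`TowerHaMa.selmerCorank_cyclotomicLayers_bounded_of_goodSS_two (hKato) (hmod)` gives that bound from Kato's Cor. 14.3 (1) on the layers (hKato),
Rohrlich's non-vanishing theorem (tree THEOREM) and the LEAD's tower-corank glue (★★ p825069 / ★★ p825270).  This file composes, with hKato = the Literature fact (G1b): `classicalNoFiniteSubmoduleSSAtTwo_of_facts (hCT) (hKato) (hmod)` — the shape that lets the registry's v2.14
(director (830)(iii): merge `stub_classicalNF` into `stub_pub`) cite slot 4a's inputs BY FACT NAME.

References: K. Kato, Astérisque 295 (2004), §14.1, Thm. 14.2 (2), Cor. 14.3 (1) (p. 235); Y. Hachimori, K. Matsuno, Proc. AMS 128 (2000)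
2539–2541; D. Rohrlich, Invent. Math. 75 (1984) 409–423; L. C. Washington, *Introduction to Cyclotomic Fields*, §13.1.
-/

set_option autoImplicit false
-- the Theorems namespace of this sub repeats the summit name by design (D-0017 nested layout: Summit.<S>.<Sub>)
set_option linter.dupNamespace false

noncomputable section

open scoped Classical NumberField

namespace Summit.BirchSwinnertonDyer.BirchSwinnertonDyer.Theorems.OddBlindNF

open Field NumberField IsDedekindDomain WeierstrassCurve CongruenceSubgroup
  Literature.NumberTheory.EllipticCurves Literature.NumberTheory.EllipticCurves.ModularForms
  Literature.NumberTheory.EllipticCurves.Rank1Residual Literature.NumberTheory.GaloisRepresentations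

/-- ★★ **CLASSICAL NF AT GOOD SUPERSINGULAR `2` FROM THREE PRINT INPUTS BY NAME** — the registry's `ClassicalNoFiniteSubmoduleSSAtTwo`
(= `stub_classicalNF`'s type in `Cruxes/SupersingularRankZeroAtTwo/Lines/odd_blind_package.lean` v2.13, = HAND-TARGETS-NF-1 §1, VERBATIM): for every
globally minimal elliptic `W/ℚ` good supersingular at `2`, every cyclotomic `(κ, γ)` and every finitely generated classical dual `S : W.SelmerDualData κ γ`,
`S.X = X(E/ℚ_∞)` has no non-zero finite `Λ`-submodule — GIVEN (hCT) the Cassels–Tate layer pairing (Literature NAMED FACT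
`HachimoriMatsuno2000.casselsTate_layerPairing`), (hKato) Kato's Cor. 14.3 (1) on the layers (the Literature NAMED FACT `kato_finite_chiPart_selmerLayer_of_twistedLValue_ne_zero`) and (hmod) modularity
(`nonempty_modularParametrizationData`).  Composition of tower-1's ★★ p823354 (Hachimori–Matsuno with bounded corank) with tower-1 GEN 64's
★★ `TowerHaMa.selmerCorank_cyclotomicLayers_bounded_of_goodSS_two` (Rohrlich = tree THEOREM + the LEAD's ★★ p825069 / ★★ p825270 tower-corank glue).
No sorry of its own; CONDITIONAL on the two displayed facts. [cite: HachimoriMatsuno2000, Theorem and Corollary (i) (p. 2540)]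
[cite: Kato2004Asterisque, Thm. 14.2 (2), Cor. 14.3 (1) (p. 235)] [cite: KitajimaOtsuki2018, Thm. 4.5 (arXiv:1607.03612 p. 18)] [cite: Matsuno2003, Prop. 4.1] -/
theorem classicalNoFiniteSubmoduleSSAtTwo_of_facts
    (hCT : HachimoriMatsuno2000.casselsTate_layerPairing.{0})
    (hKato : kato_finite_chiPart_selmerLayer_of_twistedLValue_ne_zero)
    (hmod : nonempty_modularParametrizationData) :
    ∀ (W : WeierstrassCurve ℚ) [W.IsElliptic] [W.IsGloballyMinimal], GoodSS W 2 →
      ∀ (κ : ZpExtension ℚ 2) (γ : Field.absoluteGaloisGroup ℚ),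
        κ.IsCyclotomic → κ.IsTopGenerator γ → IsCyclotomicVariable 2 γ →
      ∀ (S : W.SelmerDualData κ γ) [Module.Finite (IwasawaAlgebra 2) S.X],
        ∀ N : Submodule (IwasawaAlgebra 2) S.X, Finite N → N = ⊥ :=
  classicalNoFiniteSubmodule_goodSS_two_of_casselsTateLayerPairing_of_corankBounded hCT
    (TowerHaMa.selmerCorank_cyclotomicLayers_bounded_of_goodSS_two hKato hmod)

end Summit.BirchSwinnertonDyer.BirchSwinnertonDyer.Theorems.OddBlindNF

end
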